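import Mathlib

/-!
# Syndrome bias, part 1/5: characters of the row/column parity code

Support file for the registered stub `stub_SyndromeBias` of the line `symmetric-seed-second-order` of the crux
`CardyIKTransport.CornerLineDescent` (stmt-CriticalPhenomena-10964).  Pure finite combinatorics on patterns
`X ⊆ R × C` (`R, C : Finset ℤ`) under the product Bernoulli(`p`) weight: the characters `χ_{I,J}` of the code spanned
by rows and columns, their expectations `E_p χ_{I,J} = (1-2p)^{w(I,J)}` (`sum_wt_chi`), the `f`-twisted expectations
(`sum_wt_ind_chi`), Fourier inversion on level sets of the row/column parities (`sum_sg_chi`), the weight formula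
`w(I,J) = #I·#(C∖J) + #(R∖I)·#J` and the weight bounds for the four families of the `insert`-decomposition at the
row and the column of a marked cell.  No measure theory here; parts 2–3 finish the finite claim, part 4 is the block
gauge, part 5 assembles the stub.
-/

noncomputable section

namespace Summit.CriticalPhenomena.CardyFormulaZ2.Theorems.CornerLineDescent.SymmetricSeed

open scoped BigOperators Classical
open Finset

/-- ANCHOR OF PART 1 (proposed registered sub-goal; Mathlib-only signature). Generating identity of the product
Bernoulli weight on patterns of integer cells: `Σ_{X ⊆ s} p^{#X}(1-p)^{#s-#X} ∏_{c ∈ X} φ c = ∏_{c ∈ s} (p φ c + 1 -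
p)` — the source of every character expectation below. [folklore] -/
theorem bernoulliWeight_sum_prod : ∀ (p : ℝ) (s : Finset (ℤ × ℤ)) (φ : ℤ × ℤ → ℝ), ∑ X ∈ s.powerset, p ^ X.card * (1 - p) ^ (s.card - X.card) * ∏ c ∈ X, φ c = ∏ c ∈ s, (p * φ c + (1 - p)) := by
  intro p s φ
  rw [Finset.prod_add]
  refine Finset.sum_congr rfl fun X hX => ?_
  rw [Finset.prod_mul_distrib, Finset.prod_const, Finset.prod_const,
    Finset.card_sdiff_of_subset (Finset.mem_powerset.1 hX)]
  ring

namespace SyndromeBias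

/-- Sets with the same trace on `K` have the same members in `K`. [folklore] -/
theorem mem_iff_of_inter_eq {α : Type*} {A A' K : Set α} (h : A ∩ K = A' ∩ K) {x : α} (hx : x ∈ K) :
    x ∈ A ↔ x ∈ A' := by
  constructor
  · intro hA; exact ((Set.ext_iff.1 h x).1 ⟨hA, hx⟩).1
  · intro hA; exact ((Set.ext_iff.1 h x).2 ⟨hA, hx⟩).1

/-- Congruence of `ite` in its condition with the `Decidable` instances unified rather than synthesized. [folklore]
-/
theorem ite_congr_prop {c₁ c₂ : Prop} {d₁ : Decidable c₁} {d₂ : Decidable c₂} {α : Sort*} {x y : α}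
    (h : c₁ ↔ c₂) : @ite α c₁ d₁ x y = @ite α c₂ d₂ x y := by
  by_cases hc : c₂
  · rw [if_pos (h.2 hc), if_pos hc]
  · rw [if_neg (fun h1 => hc (h.1 h1)), if_neg hc]

/-- Row sign `(-1)^{#(X ∩ row i)}` of a syndrome pattern. [folklore] -/
def rsign (i : ℤ) (X : Finset (ℤ × ℤ)) : ℝ := ∏ c ∈ X, if c.1 = i then -1 else 1

/-- Column sign `(-1)^{#(X ∩ column j)}`. [folklore] -/
def csign (j : ℤ) (X : Finset (ℤ × ℤ)) : ℝ := ∏ c ∈ X, if c.2 = j then -1 else 1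

/-- The sign `(-1)^{[i ∈ I] + [j ∈ J]}` of the cell `(i,j)` under the character `(I, J)` of the row/column code.
[folklore] -/
def eps (I : Finset ℤ) (J : Finset ℤ) (c : ℤ × ℤ) : ℝ := if (c.1 ∈ I ↔ c.2 ∈ J) then 1 else -1

/-- The character `χ_{I,J}(X) = ∏_{c ∈ X} ε_{I,J}(c)`. [folklore] -/
def chi (I : Finset ℤ) (J : Finset ℤ) (X : Finset (ℤ × ℤ)) : ℝ := ∏ c ∈ X, eps I J c

/-- The weight of the character `(I,J)`: the number of cells with `[i ∈ I] ≠ [j ∈ J]`. [folklore] -/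
def wN (R : Finset ℤ) (C : Finset ℤ) (I : Finset ℤ) (J : Finset ℤ) : ℕ :=
  #((R ×ˢ C).filter fun c => ¬ (c.1 ∈ I ↔ c.2 ∈ J))

/-- `rsign i X = (-1)^{#(X ∩ row i)}`. [folklore] -/
theorem rsign_eq_pow (i : ℤ) (X : Finset (ℤ × ℤ)) :
    rsign i X = (-1) ^ #(X.filter fun c => c.1 = i) := by
  unfold rsign
  rw [Finset.prod_ite, Finset.prod_const, Finset.prod_const_one, mul_one]

/-- `csign j X = (-1)^{#(X ∩ column j)}`. [folklore] -/
theorem csign_eq_pow (j : ℤ) (X : Finset (ℤ × ℤ)) :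
    csign j X = (-1) ^ #(X.filter fun c => c.2 = j) := by
  unfold csign
  rw [Finset.prod_ite, Finset.prod_const, Finset.prod_const_one, mul_one]

/-- Row signs are `±1`. [folklore] -/
theorem rsign_eq_or (i : ℤ) (X : Finset (ℤ × ℤ)) : rsign i X = 1 ∨ rsign i X = -1 := by
  rw [rsign_eq_pow]; exact neg_one_pow_eq_or ℝ _

/-- Column signs are `±1`. [folklore] -/
theorem csign_eq_or (j : ℤ) (X : Finset (ℤ × ℤ)) : csign j X = 1 ∨ csign j X = -1 := by
  rw [csign_eq_pow]; exact neg_one_pow_eq_or ℝ _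

/-- `∏_{i ∈ I} rsign i X = ∏_{c ∈ X} (-1)^{[c.1 ∈ I]}`. [folklore] -/
theorem prod_rsign (I : Finset ℤ) (X : Finset (ℤ × ℤ)) :
    ∏ i ∈ I, rsign i X = ∏ c ∈ X, if c.1 ∈ I then -1 else 1 := by
  unfold rsign
  rw [Finset.prod_comm]
  refine Finset.prod_congr rfl fun c _ => ?_
  rw [Finset.prod_ite_eq]

/-- `∏_{j ∈ J} csign j X = ∏_{c ∈ X} (-1)^{[c.2 ∈ J]}`. [folklore] -/
theorem prod_csign (J : Finset ℤ) (X : Finset (ℤ × ℤ)) :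
    ∏ j ∈ J, csign j X = ∏ c ∈ X, if c.2 ∈ J then -1 else 1 := by
  unfold csign
  rw [Finset.prod_comm]
  refine Finset.prod_congr rfl fun c _ => ?_
  rw [Finset.prod_ite_eq]

/-- A character is the product of its row signs and column signs. [folklore] -/
theorem chi_eq (I : Finset ℤ) (J : Finset ℤ) (X : Finset (ℤ × ℤ)) :
    chi I J X = (∏ i ∈ I, rsign i X) * ∏ j ∈ J, csign j X := by
  rw [prod_rsign, prod_csign, ← Finset.prod_mul_distrib]
  refine Finset.prod_congr rfl fun c _ => ?_
  unfold eps
  by_cases h1 : c.1 ∈ I <;> by_cases h2 : c.2 ∈ J <;> simp [h1, h2]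

/-- CHARACTER EXPECTATION: `E_p[χ_{I,J}] = ρ^{w(I,J)}`, `ρ = 1 - 2p`. [folklore] -/
theorem sum_wt_chi (p : ℝ) (R : Finset ℤ) (C : Finset ℤ) (I : Finset ℤ) (J : Finset ℤ) :
    ∑ X ∈ (R ×ˢ C).powerset, p ^ #X * (1 - p) ^ (#(R ×ˢ C) - #X) * chi I J X =
      (1 - 2 * p) ^ wN R C I J := by
  unfold chi
  rw [bernoulliWeight_sum_prod]
  have : ∀ c ∈ R ×ˢ C, p * eps I J c + (1 - p) =
      if (c.1 ∈ I ↔ c.2 ∈ J) then 1 else (1 - 2 * p) := by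
    intro c _
    unfold eps
    split_ifs <;> ring
  rw [Finset.prod_congr rfl this, Finset.prod_ite, Finset.prod_const_one, Finset.prod_const,
    one_mul]
  rfl

/-- TWISTED CHARACTER EXPECTATION: `E_p[(1[f ∈ X] - p) ∏_{c∈X} φ c] = p(1-p)(φ f - 1) ∏_{c ≠ f}(p φ c + 1 - p)` — it
vanishes unless the character is odd at `f`. [folklore] -/
theorem sum_wt_ind_chi (p : ℝ) (s : Finset (ℤ × ℤ)) (φ : ℤ × ℤ → ℝ)
    {f : ℤ × ℤ} (hf : f ∈ s) :
    ∑ X ∈ s.powerset, p ^ #X * (1 - p) ^ (#s - #X) *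
        (((if f ∈ X then 1 else 0) - p) * ∏ c ∈ X, φ c) =
      p * (1 - p) * (φ f - 1) * ∏ c ∈ s.erase f, (p * φ c + (1 - p)) := by
  set s' := s.erase f with hs'
  have hfs' : f ∉ s' := Finset.notMem_erase f s
  have hs : s = insert f s' := (Finset.insert_erase hf).symm
  have hcard : #s = #s' + 1 := by rw [hs, Finset.card_insert_of_notMem hfs']
  rw [← bernoulliWeight_sum_prod, hs, Finset.sum_powerset_insert hfs', ← hs]
  have h1 : ∀ X ∈ s'.powerset, p ^ #X * (1 - p) ^ (#s - #X) *
      (((if f ∈ X then 1 else 0) - p) * ∏ c ∈ X, φ c) =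
      (-(p * (1 - p))) * (p ^ #X * (1 - p) ^ (#s' - #X) * ∏ c ∈ X, φ c) := by
    intro X hX
    have hXs : X ⊆ s' := Finset.mem_powerset.1 hX
    have hfX : f ∉ X := fun h => hfs' (hXs h)
    have hle : #X ≤ #s' := Finset.card_le_card hXs
    rw [if_neg hfX, hcard, show #s' + 1 - #X = (#s' - #X) + 1 by omega, pow_succ]
    ring
  have h2 : ∀ X ∈ s'.powerset, p ^ #(insert f X) * (1 - p) ^ (#s - #(insert f X)) *
      (((if f ∈ insert f X then 1 else 0) - p) * ∏ c ∈ insert f X, φ c) =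
      (p * (1 - p) * φ f) * (p ^ #X * (1 - p) ^ (#s' - #X) * ∏ c ∈ X, φ c) := by
    intro X hX
    have hXs : X ⊆ s' := Finset.mem_powerset.1 hX
    have hfX : f ∉ X := fun h => hfs' (hXs h)
    have hle : #X ≤ #s' := Finset.card_le_card hXs
    rw [if_pos (Finset.mem_insert_self f X), Finset.card_insert_of_notMem hfX,
      Finset.prod_insert hfX, hcard, show #s' + 1 - (#X + 1) = #s' - #X by omega, pow_succ]
    ring
  rw [Finset.sum_congr rfl h1, Finset.sum_congr rfl h2, ← Finset.mul_sum, ← Finset.mul_sum]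
  ring

/-- For `±1`-valued `u, v`: `∏_{i ∈ R}(1 + v i u i) = 2^{#R} 1[u = v on R]`. [folklore] -/
theorem prod_one_add_mul_sign (R : Finset ℤ) (u v : ℤ → ℝ)
    (hu : ∀ i ∈ R, u i = 1 ∨ u i = -1) (hv : ∀ i ∈ R, v i = 1 ∨ v i = -1) :
    ∏ i ∈ R, (1 + v i * u i) = if ∀ i ∈ R, u i = v i then 2 ^ #R else 0 := by
  by_cases h : ∀ i ∈ R, u i = v i
  · rw [if_pos h]
    rw [Finset.prod_congr rfl (fun i hi => ?_), Finset.prod_const]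
    rw [h i hi]
    rcases hv i hi with h1 | h1 <;> rw [h1] <;> norm_num
  · rw [if_neg h]
    simp only [not_forall] at h
    obtain ⟨i, hi, hne⟩ := h
    apply Finset.prod_eq_zero hi
    rcases hu i hi with h1 | h1 <;> rcases hv i hi with h2 | h2 <;> simp_all

/-- FOURIER INVERSION on the row/column code: `Σ_{I ⊆ R, J ⊆ C} sg(I,J) χ_{I,J}(X) = 2^{#R} 2^{#C} 1[X has the row
and column signs of X₀]`. [folklore] -/
theorem sum_sg_chi (R : Finset ℤ) (C : Finset ℤ) (X X₀ : Finset (ℤ × ℤ)) :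
    ∑ I ∈ R.powerset, ∑ J ∈ C.powerset,
        ((∏ i ∈ I, rsign i X₀) * ∏ j ∈ J, csign j X₀) * chi I J X =
      if (∀ i ∈ R, rsign i X = rsign i X₀) ∧ (∀ j ∈ C, csign j X = csign j X₀)
        then 2 ^ #R * 2 ^ #C else 0 := by
  have hsum : ∀ I ∈ R.powerset, ∑ J ∈ C.powerset,
      ((∏ i ∈ I, rsign i X₀) * ∏ j ∈ J, csign j X₀) * chi I J X =
      (∏ i ∈ I, rsign i X₀ * rsign i X) * ∑ J ∈ C.powerset, ∏ j ∈ J, csign j X₀ * csign j X := by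
    intro I _
    rw [Finset.mul_sum]
    refine Finset.sum_congr rfl fun J _ => ?_
    rw [chi_eq, Finset.prod_mul_distrib, Finset.prod_mul_distrib]
    ring
  rw [Finset.sum_congr rfl hsum, ← Finset.sum_mul, ← Finset.prod_one_add, ← Finset.prod_one_add,
    prod_one_add_mul_sign R (fun i => rsign i X) (fun i => rsign i X₀)
      (fun i _ => rsign_eq_or i X) (fun i _ => rsign_eq_or i X₀),
    prod_one_add_mul_sign C (fun j => csign j X) (fun j => csign j X₀)
      (fun j _ => csign_eq_or j X) (fun j _ => csign_eq_or j X₀)]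
  split_ifs <;> simp_all

/-- The weight of `(I, J)` is `#I·#(C∖J) + #(R∖I)·#J`. [folklore] -/
theorem wN_eq (R : Finset ℤ) (C : Finset ℤ) {I : Finset ℤ} {J : Finset ℤ}
    (hI : I ⊆ R) (hJ : J ⊆ C) :
    wN R C I J = #I * #(C \ J) + #(R \ I) * #J := by
  unfold wN
  have hset : (R ×ˢ C).filter (fun c => ¬ (c.1 ∈ I ↔ c.2 ∈ J)) =
      (I ×ˢ (C \ J)) ∪ ((R \ I) ×ˢ J) := by
    ext ⟨a, b⟩
    simp only [Finset.mem_filter, Finset.mem_product, Finset.mem_union, Finset.mem_sdiff]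
    have ha := @hI a
    have hb := @hJ b
    tauto
  rw [hset, Finset.card_union_of_disjoint, Finset.card_product, Finset.card_product]
  rw [Finset.disjoint_left]
  rintro ⟨a, b⟩ h1 h2
  simp only [Finset.mem_product, Finset.mem_sdiff] at h1 h2
  exact h2.1.2 h1.1

/-- Consistency: the product of all row signs equals the product of all column signs (both are `(-1)^{#X₀}`), so
`sg(R, C) = 1`. [folklore] -/
theorem prod_rsign_mul_prod_csign (R : Finset ℤ) (C : Finset ℤ) {X₀ : Finset (ℤ × ℤ)}
    (hX₀ : X₀ ⊆ R ×ˢ C) :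
    (∏ i ∈ R, rsign i X₀) * ∏ j ∈ C, csign j X₀ = 1 := by
  rw [prod_rsign, prod_csign]
  have h1 : ∏ c ∈ X₀, (if c.1 ∈ R then (-1 : ℝ) else 1) = ∏ c ∈ X₀, (-1 : ℝ) :=
    Finset.prod_congr rfl fun c hc => by rw [if_pos (Finset.mem_product.1 (hX₀ hc)).1]
  have h2 : ∏ c ∈ X₀, (if c.2 ∈ C then (-1 : ℝ) else 1) = ∏ c ∈ X₀, (-1 : ℝ) :=
    Finset.prod_congr rfl fun c hc => by rw [if_pos (Finset.mem_product.1 (hX₀ hc)).2]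
  rw [h1, h2, ← Finset.prod_mul_distrib]
  simp

/-- Double `powerset`-`insert` decomposition: the four families `(I', J'), (I', J'+j₀), (I'+i₀, J'), (I'+i₀,
J'+j₀)`. [folklore] -/
theorem sum_powerset_insert₂ {R C R' C' : Finset ℤ} {i₀ j₀ : ℤ} (hR : insert i₀ R' = R)
    (hC : insert j₀ C' = C) (hi : i₀ ∉ R') (hj : j₀ ∉ C') (F : Finset ℤ → Finset ℤ → ℝ) :
    ∑ I ∈ R.powerset, ∑ J ∈ C.powerset, F I J =
      ∑ I ∈ R'.powerset, ∑ J ∈ C'.powerset,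
        (F I J + F I (insert j₀ J) + F (insert i₀ I) J + F (insert i₀ I) (insert j₀ J)) := by
  subst hR; subst hC
  rw [Finset.sum_powerset_insert hi]
  simp_rw [Finset.sum_powerset_insert hj]
  rw [← Finset.sum_add_distrib]
  refine Finset.sum_congr rfl fun I _ => ?_
  rw [← Finset.sum_add_distrib, ← Finset.sum_add_distrib, ← Finset.sum_add_distrib]
  refine Finset.sum_congr rfl fun J _ => ?_
  ring

/-- `#((insert x s) ∖ t) = #(s ∖ t) + 1` for `x ∉ s ⊇ t`. [folklore] -/
theorem card_insert_sdiff' {s t : Finset ℤ} {x : ℤ} (hx : x ∉ s) (ht : t ⊆ s) :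
    #(insert x s \ t) = #(s \ t) + 1 := by
  rw [Finset.insert_sdiff_of_notMem _ (fun h => hx (ht h)), Finset.card_insert_of_notMem]
  simp [hx]

/-- `(insert x s) ∖ (insert x t) = s ∖ t` for `x ∉ s`. [folklore] -/
theorem insert_sdiff_insert' {s t : Finset ℤ} {x : ℤ} (hx : x ∉ s) :
    insert x s \ insert x t = s \ t := by
  ext y
  simp only [Finset.mem_sdiff, Finset.mem_insert]
  have h : y ∈ s → ¬ y = x := fun hy hyx => hx (hyx ▸ hy)
  tauto

/-- The weights of the four families in terms of `a = #I'`, `b = #J'`, `a' = #(R'∖I')`, `b' = #(C'∖J')`. [folklore]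
-/
theorem wN_four {R C : Finset ℤ} {i₀ j₀ : ℤ} (hi₀ : i₀ ∈ R) (hj₀ : j₀ ∈ C) {I' J' : Finset ℤ}
    (hI' : I' ⊆ R.erase i₀) (hJ' : J' ⊆ C.erase j₀) :
    wN R C I' J' = #I' * (#(C.erase j₀ \ J') + 1) + (#(R.erase i₀ \ I') + 1) * #J' ∧
    wN R C (insert i₀ I') J' = (#I' + 1) * (#(C.erase j₀ \ J') + 1) + #(R.erase i₀ \ I') * #J' ∧
    wN R C I' (insert j₀ J') = #I' * #(C.erase j₀ \ J') + (#(R.erase i₀ \ I') + 1) * (#J' + 1) ∧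
    wN R C (insert i₀ I') (insert j₀ J') =
      (#I' + 1) * #(C.erase j₀ \ J') + #(R.erase i₀ \ I') * (#J' + 1) := by
  set R' := R.erase i₀ with hR'
  set C' := C.erase j₀ with hC'
  have hi : i₀ ∉ R' := Finset.notMem_erase i₀ R
  have hj : j₀ ∉ C' := Finset.notMem_erase j₀ C
  have hR : insert i₀ R' = R := Finset.insert_erase hi₀
  have hC : insert j₀ C' = C := Finset.insert_erase hj₀
  have hiI : i₀ ∉ I' := fun h => hi (hI' h)
  have hjJ : j₀ ∉ J' := fun h => hj (hJ' h)
  have hR'R : R' ⊆ R := Finset.erase_subset i₀ R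
  have hC'C : C' ⊆ C := Finset.erase_subset j₀ C
  have h1 : #(C \ J') = #(C' \ J') + 1 := by rw [← hC, card_insert_sdiff' hj hJ']
  have h2 : #(R \ I') = #(R' \ I') + 1 := by rw [← hR, card_insert_sdiff' hi hI']
  have h3 : #(R \ insert i₀ I') = #(R' \ I') := by rw [← hR, insert_sdiff_insert' hi]
  have h4 : #(C \ insert j₀ J') = #(C' \ J') := by rw [← hC, insert_sdiff_insert' hj]
  have h5 : #(insert i₀ I') = #I' + 1 := Finset.card_insert_of_notMem hiI
  have h6 : #(insert j₀ J') = #J' + 1 := Finset.card_insert_of_notMem hjJ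
  have hIR : insert i₀ I' ⊆ R := Finset.insert_subset hi₀ (hI'.trans hR'R)
  have hJC : insert j₀ J' ⊆ C := Finset.insert_subset hj₀ (hJ'.trans hC'C)
  refine ⟨?_, ?_, ?_, ?_⟩
  · rw [wN_eq R C (hI'.trans hR'R) (hJ'.trans hC'C), h1, h2]
  · rw [wN_eq R C hIR (hJ'.trans hC'C), h1, h3, h5]
  · rw [wN_eq R C (hI'.trans hR'R) hJC, h4, h2, h6]
  · rw [wN_eq R C hIR hJC, h4, h3, h5, h6]

/-- `2ab ≤ r(a+b)` when `a + b ≤ 2r` (AM–GM). [folklore] -/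
theorem arith_key {a b r : ℕ} (h : a + b ≤ 2 * r) : (2 * a * b : ℤ) ≤ r * (a + b) := by
  have h' : ((a : ℤ) + b) ≤ 2 * r := by exact_mod_cast h
  nlinarith [sq_nonneg ((a : ℤ) - b), mul_nonneg (by positivity : (0 : ℤ) ≤ a + b) (sub_nonneg.2 h')]

/-- Family 1, light half: `w ≥ (r+1)(a+b)`. [folklore] -/
theorem arith1a {a b a' b' r : ℕ} (ha : a + a' = 2 * r) (hb : b + b' = 2 * r)
    (h : a + b ≤ 2 * r) : (r + 1) * (a + b) ≤ a * (b' + 1) + (a' + 1) * b := by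
  have key := arith_key h
  zify
  have ha' : (a' : ℤ) = 2 * r - a := by omega
  have hb' : (b' : ℤ) = 2 * r - b := by omega
  rw [ha', hb']
  nlinarith [key]

/-- Family 1, heavy half: `w ≥ 4r + (r-1)(a'+b')`. [folklore] -/
theorem arith1b {a b a' b' r : ℕ} (ha : a + a' = 2 * r) (hb : b + b' = 2 * r)
    (h : a' + b' ≤ 2 * r) : 4 * r + (r - 1) * (a' + b') ≤ a * (b' + 1) + (a' + 1) * b := by
  have key := arith_key h
  rcases Nat.eq_zero_or_pos r with hr | hr
  · subst hr
    have : a = 0 := by omega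
    have : b = 0 := by omega
    have : a' = 0 := by omega
    have : b' = 0 := by omega
    subst_vars; simp
  zify [hr]
  have ha' : (a : ℤ) = 2 * r - a' := by omega
  have hb' : (b : ℤ) = 2 * r - b' := by omega
  rw [ha', hb']
  nlinarith [key]

/-- Families 2/3 (the characters through `f`): `w ≥ 2r + 1 + (r-1)(a+b)`; the two characters with `a + b = 0` are
the row and the column of `f`, of weight exactly `2r+1`. [folklore] -/
theorem arith2 {a b a' b' r : ℕ} (ha : a + a' = 2 * r) (hb : b + b' = 2 * r)
    (h : a + b ≤ 2 * r) : 2 * r + 1 + (r - 1) * (a + b) ≤ (a + 1) * (b' + 1) + a' * b := by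
  have key := arith_key h
  rcases Nat.eq_zero_or_pos r with hr | hr
  · subst hr
    have : a = 0 := by omega
    have : b = 0 := by omega
    have : a' = 0 := by omega
    have : b' = 0 := by omega
    subst_vars; simp
  zify [hr]
  have ha' : (a' : ℤ) = 2 * r - a := by omega
  have hb' : (b' : ℤ) = 2 * r - b := by omega
  rw [ha', hb']
  nlinarith [key]

/-- Family-1 weight bound as a bound on `ρ^w`. [folklore] -/
theorem pw1 {ρ : ℝ} (h0 : 0 ≤ ρ) (h1 : ρ ≤ 1) {a b a' b' r : ℕ} (ha : a + a' = 2 * r)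
    (hb : b + b' = 2 * r) :
    ρ ^ (a * (b' + 1) + (a' + 1) * b) ≤
      (ρ ^ (r + 1)) ^ (a + b) + ρ ^ (4 * r) * (ρ ^ (r - 1)) ^ (a' + b') := by
  have hx : 0 ≤ (ρ ^ (r + 1)) ^ (a + b) := by positivity
  have hy : 0 ≤ ρ ^ (4 * r) * (ρ ^ (r - 1)) ^ (a' + b') := by positivity
  rcases le_or_gt (a + b) (2 * r) with h | h
  · calc ρ ^ (a * (b' + 1) + (a' + 1) * b) ≤ ρ ^ ((r + 1) * (a + b)) :=
          pow_le_pow_of_le_one h0 h1 (arith1a ha hb h)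
      _ = (ρ ^ (r + 1)) ^ (a + b) := by rw [← pow_mul]
      _ ≤ _ := le_add_of_nonneg_right hy
  · have h' : a' + b' ≤ 2 * r := by omega
    calc ρ ^ (a * (b' + 1) + (a' + 1) * b) ≤ ρ ^ (4 * r + (r - 1) * (a' + b')) :=
          pow_le_pow_of_le_one h0 h1 (arith1b ha hb h')
      _ = ρ ^ (4 * r) * (ρ ^ (r - 1)) ^ (a' + b') := by rw [← pow_mul, ← pow_add]
      _ ≤ _ := le_add_of_nonneg_left hx

/-- Family-2 weight bound as a bound on `ρ^{w-1}`: `ρ^{w-1} ≤ ρ^{2r}(x^{a+b} + x^{a'+b'})`, `x = ρ^{r-1}`.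
[folklore] -/
theorem pw2 {ρ : ℝ} (h0 : 0 ≤ ρ) (h1 : ρ ≤ 1) {a b a' b' r : ℕ} (ha : a + a' = 2 * r)
    (hb : b + b' = 2 * r) :
    ρ ^ ((a + 1) * (b' + 1) + a' * b - 1) ≤
      ρ ^ (2 * r) * ((ρ ^ (r - 1)) ^ (a + b) + (ρ ^ (r - 1)) ^ (a' + b')) := by
  have hx : 0 ≤ (ρ ^ (r - 1)) ^ (a + b) := by positivity
  have hy : 0 ≤ (ρ ^ (r - 1)) ^ (a' + b') := by positivity
  have h2r : 0 ≤ ρ ^ (2 * r) := by positivity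
  rcases le_or_gt (a + b) (2 * r) with h | h
  · have := arith2 ha hb h
    calc ρ ^ ((a + 1) * (b' + 1) + a' * b - 1) ≤ ρ ^ (2 * r + (r - 1) * (a + b)) :=
          pow_le_pow_of_le_one h0 h1 (by omega)
      _ = ρ ^ (2 * r) * (ρ ^ (r - 1)) ^ (a + b) := by rw [← pow_mul, ← pow_add]
      _ ≤ _ := by rw [mul_add]; exact le_add_of_nonneg_right (mul_nonneg h2r hy)
  · have h' : b' + a' ≤ 2 * r := by omega
    have := arith2 (by omega : b' + b = 2 * r) (by omega : a' + a = 2 * r) h'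
    have h'' : 2 * r + 1 + (r - 1) * (a' + b') ≤ (a + 1) * (b' + 1) + a' * b := by
      rw [show (b' + 1) * (a + 1) + b * a' = (a + 1) * (b' + 1) + a' * b by ring,
        show b' + a' = a' + b' by ring] at this
      exact this
    calc ρ ^ ((a + 1) * (b' + 1) + a' * b - 1) ≤ ρ ^ (2 * r + (r - 1) * (a' + b')) :=
          pow_le_pow_of_le_one h0 h1 (by omega)
      _ = ρ ^ (2 * r) * (ρ ^ (r - 1)) ^ (a' + b') := by rw [← pow_mul, ← pow_add]
      _ ≤ _ := by rw [mul_add]; exact le_add_of_nonneg_left (mul_nonneg h2r hx)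

end SyndromeBias

end Summit.CriticalPhenomena.CardyFormulaZ2.Theorems.CornerLineDescent.SymmetricSeed
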